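import Summits.ResolutionOfSingularities.ResolutionOfSingularities.Theorems.PurelyInseparableDim4MohAlongFace
import Summits.ResolutionOfSingularities.ResolutionOfSingularities.Theorems.PurelyInseparableDim4JumpLedgerAlong
import HarnessLib

/-!
# Purely inseparable four-folds — Moh's witness under moves along the centre, and Moh's STABILITY
# theorem (`e = 1`) along branches with translated points (PR-1 (b), generic form)

[OURS · counted 0 · cell `res-dim4-pi`, D-0157 DOOR 2, brick PR-1 (b) «Moh stability, sequence form,
along translated edges» (desk GO 16:40:32Z); AI work, weaker than expert review] Nothing here is a
statement about resolution of singularities (NOT proved in dimension `≥ 4` / characteristic `p`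
anywhere in this programme); census/instrument value only.

The tree's `CentreBlowup.shade_le_shade_add_one_along` (Moh's Stability Theorem at order `p` for
Moh-permissible coordinate centres) follows sequences of blow-ups read at points of the FIBRE OVER THE
ORIGIN. Its proof carries MOH'S WITNESS — a non-exceptional variable `y_{i₀}` occurring in an initial
monomial with an exponent prime to `p` — which a jump creates, which forbids a further jump, and which
survives stalls. Along the engines' branches an edge goes to a point `b' + c` over ANOTHER point `c` of
the centre: the state is first MOVED to `c` (`PurelyInseparableDim4MohAlong*.lean`). A move at which
the shade does not jump can still KILL the witness (hand example in the cell's bus: `p = 2`,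
`F = x₀²x₁(1 + x₂) + x₀³x₂`, `r = (1,0,0,0)`, `S = {0,1}`, `c₂ = 1`: the moved state
`x₀²x₁x₂ + x₀³x₂ + x₀³` has the same shade but its only initial monomial `x₀³` is exceptional-only),
so the tree's method does not transfer verbatim. This file proves the GENERIC form:

* §1 `exists_witness_translate` — **the witness survives every move avoiding its hypersurface**: if
  `(i₀, E)` is a witness of `s` (`r_{i₀} = 0`, `E` initial, `p ∤ E_{i₀}`), `C_S` satisfies (2) at `s`,
  and the FACE SUM of `E` at `c`, `Σ_{D ∈ supp F, D = E where c = 0} a_D ∏_{c_i ≠ 0} c_i^{D_i}`, does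
  not vanish, then `(i₀, E|_{c = 0})` is a witness of the moved state `s@c` AND the shade does not
  jump at `c` (`shade_translate_eq_of_witness`).
* §2 `shade_step_add_le_of_witness` — hence NO RISE on the translated edge `b' + c` from a state with
  such a witness (the tree's `shade_step_le_of_witness` at `c`).
* §3 `shade_le_shade_add_one_along_translate` — **Moh's stability along branches with translated
  points, generic form**: along any sequence `s_{n+1} = step p Sₙ jₙ (b'ₙ + cₙ) sₙ` with (1) ∧ (2) at
  every `sₙ`, no shade jump at every move `cₙ`, and every move avoiding the hypersurfaces of the
  witnesses of `sₙ` (face sums `≠ 0`), `shade(s_m) ≤ shade(s_n) + 1` for all `n ≤ m`. The fibre case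
  (`cₙ = 0`) is the tree's theorem; whether the face-sum clause can be dropped (stability along ALL
  no-jump zigzag branches) is OPEN here — a local search over `𝔽₂` (≈ 2·10⁵ starts, depth ≤ 3,
  cell bus 16:5xZ) found no violation, and the witness method provably does not decide it.

bears_on: LADDER-RESOLUTION:D157-DOOR2 (res-dim4-pi · PR-1 (b)). Supports
stmt-ResolutionOfSingularities-16155 (helper).
-/

set_option linter.dupNamespace false

noncomputable section

open MvPolynomial Finset

open scoped BigOperators

namespace Summit.ResolutionOfSingularities.ResolutionOfSingularities.Theorems.PIDim4

open Literature.AlgebraicGeometry.Resolution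
open Literature.AlgebraicGeometry.Resolution.Hauser2010
open Literature.AlgebraicGeometry.Resolution.CentreBlowup
open Literature.Barriers.ResolutionOfSingularities

namespace MohAlong

/-! ## 1. The witness survives a move avoiding its hypersurface -/

section Witness

variable {σ : Type*} {K : Type*} [Field K] [Fintype σ] [DecidableEq σ] [DecidableEq K]

omit [DecidableEq K] in
/-- **Under (2), an initial monomial carries exactly the exceptional exponents off `S`**: if `E` is an
initial monomial of `F` (`|E| = ord₀ F`), `y^r ∣ y^E` and every monomial has `degIn S ≥ degIn S r +
(o − |r|)`, then `E_i = r_i` for every `i ∉ S` (and `degIn S E = degIn S r + (o − |r|)`). [folklore] -/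
theorem apply_eq_of_initial {S : Finset σ} (s : CState σ K) {o : ℕ}
    (hperm : ∀ d ∈ s.F.support, degIn S s.r + (o - s.r.degree) ≤ degIn S d)
    {E : σ →₀ ℕ} (hE : E ∈ s.F.support) (hrE : s.r ≤ E) (hEdeg : E.degree = o) :
    (∀ i, i ∉ S → E i = s.r i) ∧ degIn S E = degIn S s.r + (o - s.r.degree) := by
  have h1 := degIn_add_sum_compl S E
  have h2 := degIn_add_sum_compl S s.r
  have h3 : ∀ i ∈ Sᶜ, s.r i ≤ E i := fun i _ => Finsupp.le_def.mp hrE i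
  have h4 : ∑ i ∈ Sᶜ, s.r i ≤ ∑ i ∈ Sᶜ, E i := Finset.sum_le_sum h3
  have h5 := hperm E hE
  have h6 : s.r.degree ≤ E.degree := PointBlowup.degree_le_degree_of_le hrE
  have hsum : ∑ i ∈ Sᶜ, E i = ∑ i ∈ Sᶜ, s.r i := by omega
  refine ⟨fun i hi => ?_, by omega⟩
  -- termwise equality from the equality of sums of a pointwise `≤`
  have hi' : i ∈ Sᶜ := Finset.mem_compl.mpr hi
  have := (Finset.sum_eq_sum_iff_of_le h3).mp hsum.symm i hi'
  exact this.symm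

/-- **The witness survives a move avoiding its hypersurface, and the shade does not jump there.**
Let `s = (F, r, exc)` have order `o`, `y^r ∣ F`, and let `C_S` satisfy (2) at `s`; let `c` be a point
of the centre (`c = 0` on `S`). If `E` is an initial monomial of `F` with `p ∤ E_{i₀}` at a variable
with `c_{i₀} = 0`, and the FACE SUM of `E` at `c` — the Taylor coefficient of `F(y + c)` at `E|_{c=0}`,
`Σ_{D ∈ supp F, D_i = E_i (c_i = 0)} a_D · ∏_{c_i ≠ 0} c_i^{D_i}` — is non-zero, then `E|_{c=0}` is an
INITIAL monomial of the moved-and-re-cleaned polynomial, of degree `|r|_{c=0}| + (o − |r|)`, with the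
same exponent `E_{i₀}` at `i₀`. [folklore] -/
theorem exists_witness_translate (p : ℕ) {S : Finset σ} (c : σ → K) (hc : ∀ i ∈ S, c i = 0)
    (s : CState σ K) {o : ℕ} (hr : ∀ d ∈ s.F.support, s.r ≤ d)
    (hperm : ∀ d ∈ s.F.support, degIn S s.r + (o - s.r.degree) ≤ degIn S d)
    {i₀ : σ} (hci₀ : c i₀ = 0) {E : σ →₀ ℕ} (hE : E ∈ s.F.support) (hEdeg : E.degree = o)
    (hEi₀ : ¬ p ∣ E i₀)
    (hsum : ∑ D ∈ s.F.support with (∀ i, c i = 0 → D i = E i),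
        coeff D s.F * ∏ i ∈ (Finset.univ.filter fun i => c i = 0)ᶜ, c i ^ D i ≠ 0) :
    E.filter (fun i => c i = 0) ∈ (deletePthPowers p (PointBlowup.translate c s.F)).support ∧
      ordZero (deletePthPowers p (PointBlowup.translate c s.F)) =
        (((s.r.filter (fun i => c i = 0)).degree + (o - s.r.degree) : ℕ) : ℕ∞) ∧
      (E.filter (fun i => c i = 0)).degree = (s.r.filter (fun i => c i = 0)).degree + (o - s.r.degree) ∧
      E.filter (fun i => c i = 0) i₀ = E i₀ := by
  set S₀ : Finset σ := Finset.univ.filter fun i => c i = 0 with hS₀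
  set e : σ →₀ ℕ := E.filter (fun i => c i = 0) with he
  have hS₀c : ∀ i ∈ S₀, c i = 0 := fun i hi => (Finset.mem_filter.mp hi).2
  have heN : ∀ i, i ∉ S₀ → e i = 0 := fun i hi => by
    rw [he, Finsupp.filter_apply, if_neg]
    exact fun h0 => hi (Finset.mem_filter.mpr ⟨Finset.mem_univ _, h0⟩)
  have hei₀ : e i₀ = E i₀ := by rw [he, Finsupp.filter_apply, if_pos hci₀]
  -- the Taylor coefficient at `e` is the face sum
  have hcoeffT : coeff e (PointBlowup.translate c s.F) ≠ 0 := by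
    rw [coeff_translate_of_supported c hS₀c heN]
    have hfilt : (s.F.support.filter fun D => ∀ i ∈ S₀, D i = e i) =
        s.F.support.filter fun D => ∀ i, c i = 0 → D i = E i := by
      refine Finset.filter_congr fun D _ => ⟨fun h i hi => ?_, fun h i hi => ?_⟩
      · have := h i (Finset.mem_filter.mpr ⟨Finset.mem_univ _, hi⟩)
        rwa [he, Finsupp.filter_apply, if_pos hi] at this
      · rw [he, Finsupp.filter_apply, if_pos (hS₀c i hi)]
        exact h i (hS₀c i hi)
    rw [hfilt]
    exact hsum
  have hnp : ¬ IsPthPowerExponent p e := fun h =>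
    hEi₀ (hei₀ ▸ (isPthPowerExponent_iff p e).mp h i₀)
  have hmem : e ∈ (deletePthPowers p (PointBlowup.translate c s.F)).support := by
    rw [MvPolynomial.mem_support_iff, coeff_deletePthPowers, if_neg hnp]
    exact hcoeffT
  -- degrees: |e| ≤ |r'| + d ≤ ord ≤ |e|
  have hrE : s.r ≤ E := hr E hE
  have hsplitE := congrArg Finsupp.degree (Finsupp.filter_add_filter_not E (fun i => c i = 0))
  have hsplitr := congrArg Finsupp.degree (Finsupp.filter_add_filter_not s.r (fun i => c i = 0))
  rw [map_add] at hsplitE hsplitr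
  have hle1 : (s.r.filter fun i => ¬ c i = 0).degree ≤ (E.filter fun i => ¬ c i = 0).degree :=
    PointBlowup.degree_le_degree_of_le (Finsupp.le_def.mpr fun i => by
      rw [Finsupp.filter_apply, Finsupp.filter_apply]
      split_ifs
      · exact le_rfl
      · exact Finsupp.le_def.mp hrE i)
  have hle2 : s.r.degree ≤ E.degree := PointBlowup.degree_le_degree_of_le hrE
  have hupper : e.degree ≤ (s.r.filter (fun i => c i = 0)).degree + (o - s.r.degree) := by
    rw [he]; omega
  have hlower := le_ordZero_clean_translate p c hc hr hperm
  have hord := ordZero_le_of_coeff_ne_zero _ _ (MvPolynomial.mem_support_iff.mp hmem)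
  have h3 : (((s.r.filter (fun i => c i = 0)).degree + (o - s.r.degree) : ℕ) : ℕ∞) ≤ (e.degree : ℕ∞) :=
    le_trans hlower hord
  have h3' : (s.r.filter (fun i => c i = 0)).degree + (o - s.r.degree) ≤ e.degree := by exact_mod_cast h3
  have hdeg : e.degree = (s.r.filter (fun i => c i = 0)).degree + (o - s.r.degree) := le_antisymm hupper h3'
  refine ⟨hmem, le_antisymm ?_ hlower, hdeg, hei₀⟩
  rw [← hdeg]
  exact hord

/-- **No shade jump at a move avoiding the hypersurface of a witness monomial.** [folklore] -/
theorem shade_translate_eq_of_witness (p : ℕ) {S : Finset σ} (c : σ → K) (hc : ∀ i ∈ S, c i = 0)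
    (s : CState σ K) {o : ℕ} (ho : ordZero s.F = o) (hr : ∀ d ∈ s.F.support, s.r ≤ d)
    (hperm : ∀ d ∈ s.F.support, degIn S s.r + (o - s.r.degree) ≤ degIn S d)
    {i₀ : σ} (hci₀ : c i₀ = 0) {E : σ →₀ ℕ} (hE : E ∈ s.F.support) (hEdeg : E.degree = o)
    (hEi₀ : ¬ p ∣ E i₀)
    (hsum : ∑ D ∈ s.F.support with (∀ i, c i = 0 → D i = E i),
        coeff D s.F * ∏ i ∈ (Finset.univ.filter fun i => c i = 0)ᶜ, c i ^ D i ≠ 0) :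
    CState.shade ⟨deletePthPowers p (PointBlowup.translate c s.F),
      s.r.filter (fun i => c i = 0), s.exc.filter (fun i => c i = 0)⟩ = s.shade := by
  obtain ⟨-, hord, -, -⟩ := exists_witness_translate p c hc s hr hperm hci₀ hE hEdeg hEi₀ hsum
  rw [CState.shade_eq_of_ordZero_eq s ho]
  unfold CState.shade
  dsimp only
  rw [hord, ← ENat.coe_sub, Nat.add_sub_cancel_left]

end Witness

/-! ## 2. No rise on a translated edge from a state with a surviving witness -/

section NoRise

variable {σ : Type*} {K : Type*} [Field K] [Fintype σ] [DecidableEq σ] [DecidableEq K]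
variable (p : ℕ) [hp : Fact p.Prime] [CharP K p]

/-- **Moh's witness forbids a rise on a translated edge** (chart `j ∈ S`, point `b' + c`, `b'` a
fibre coordinate, `c` on the centre): if `s` (clean, `y^r ∣ F`, (1) ∧ (2) for `C_S`) has a witness
`(i₀, E)` — `r_{i₀} = 0`, `E` initial, `p ∤ E_{i₀}` — whose face sum at `c` is non-zero, then
`shade(step p S j (b' + c) s) ≤ shade(s)`: the witness moves to `c` (§1) and the tree's
`CentreBlowup.shade_step_le_of_witness` applies at `c`. [cite: Moh1987, §1 (p. 972)] -/
theorem shade_step_add_le_of_witness {S : Finset σ} {j : σ} (hj : j ∈ S) (b' c : σ → K)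
    (hb'j : b' j = 0) (hb' : ∀ i, i ∉ S → b' i = 0) (hc : ∀ i ∈ S, c i = 0) (s : CState σ K)
    (hclean : deletePthPowers p s.F = s.F) {o : ℕ} (ho : ordZero s.F = o)
    (hr : ∀ d ∈ s.F.support, s.r ≤ d) (hq : ∀ d ∈ s.F.support, p ≤ degIn S d)
    (hperm : ((degIn S s.r : ℕ) : ℕ∞) + s.shade ≤ ordAlong S s.F)
    {i₀ : σ} (hri₀ : s.r i₀ = 0) (hci₀ : c i₀ = 0) {E : σ →₀ ℕ} (hE : E ∈ s.F.support)
    (hEdeg : E.degree = o) (hEi₀ : ¬ p ∣ E i₀)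
    (hsum : ∑ D ∈ s.F.support with (∀ i, c i = 0 → D i = E i),
        coeff D s.F * ∏ i ∈ (Finset.univ.filter fun i => c i = 0)ᶜ, c i ^ D i ≠ 0) :
    (step p S j (b' + c) s).shade ≤ s.shade := by
  set M : CState σ K := ⟨deletePthPowers p (PointBlowup.translate c s.F),
    s.r.filter (fun i => c i = 0), s.exc.filter (fun i => c i = 0)⟩ with hM
  have hpermN := perm_of_shade_le_ordAlong s ho hperm
  obtain ⟨heM, hordM, heMdeg, hei₀⟩ :=
    exists_witness_translate p c hc s hr hpermN hci₀ hE hEdeg hEi₀ hsum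
  have heq := shade_translate_eq_of_witness p c hc s ho hr hpermN hci₀ hE hEdeg hEi₀ hsum
  obtain ⟨-, hrM, hqM, hpermM⟩ := JumpLedger.translate_hypotheses p c hc s hclean hr hq hperm heq hordM
  rw [step_add_eq_step_translate_clean_one p hj b' c hb' hc s hclean, ← heq]
  have hri₀M : M.r i₀ = 0 := by
    show (s.r.filter (fun i => c i = 0)) i₀ = 0
    rw [Finsupp.filter_apply, if_pos hci₀, hri₀]
  exact shade_step_le_of_witness p hj b' hb'j hb' M hordM hrM hqM hpermM hri₀M heM heMdeg
    (by rw [hei₀]; exact hEi₀)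

end NoRise

/-! ## 3. Moh's stability theorem along branches with translated points (generic form) -/

section Along

variable {σ : Type*} {K : Type*} [Field K] [Fintype σ] [DecidableEq σ] [DecidableEq K]
variable (p : ℕ) [hp : Fact p.Prime] [CharP K p]

/-- **Moh's Stability Theorem at order `p` (`e = 1`) along branches with TRANSLATED points, generic
form.** Follow any sequence `s_{n+1} = step p Sₙ jₙ (b'ₙ + cₙ) sₙ` of blow-ups of coordinate centres
`C_{Sₙ}` (`jₙ ∈ Sₙ`) read at ARBITRARY points `b'ₙ + cₙ` of the new exceptional hyperplane (`b'ₙ` the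
fibre coordinate, `cₙ` the point of the centre it lies over), starting from a cleaned state (`F ≠ 0`,
`y^r ∣ F`), such that at every stage: (1) `p ≤ degIn Sₙ` and (2) `degIn Sₙ rₙ + shade ≤ ord_{C_{Sₙ}}`
hold at `sₙ`; the shade does not jump at the move to `cₙ`; and every witness `(i, E)` of `sₙ`
(`rₙ i = 0`, `cₙ i = 0`, `E` initial, `p ∤ E_i`) has non-zero face sum at `cₙ`. Then
`shade(s_m) ≤ shade(s_n) + 1` for all `n ≤ m`. For `cₙ = 0` the last two clauses are automatic and
this is `CentreBlowup.shade_le_shade_add_one_along`. [cite: Moh1987, Stability Theorem (Introduction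
p. 966) and §1 (pp. 972–973)] -/
theorem shade_le_shade_add_one_along_translate (s : ℕ → CState σ K) (S : ℕ → Finset σ)
    (j : ℕ → σ) (b' c : ℕ → σ → K) (hj : ∀ n, j n ∈ S n) (hb'j : ∀ n, b' n (j n) = 0)
    (hb' : ∀ n i, i ∉ S n → b' n i = 0) (hc : ∀ n, ∀ i ∈ S n, c n i = 0)
    (hstep : ∀ n, s (n + 1) = step p (S n) (j n) (b' n + c n) (s n))
    (hF0 : (s 0).F ≠ 0) (hclean : deletePthPowers p (s 0).F = (s 0).F)
    (hr : ∀ d ∈ (s 0).F.support, (s 0).r ≤ d)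
    (hq : ∀ n, ∀ d ∈ (s n).F.support, p ≤ degIn (S n) d)
    (hperm : ∀ n, ((degIn (S n) (s n).r : ℕ) : ℕ∞) + (s n).shade ≤ ordAlong (S n) (s n).F)
    (hnojump : ∀ n, CState.shade ⟨deletePthPowers p (PointBlowup.translate (c n) (s n).F),
      (s n).r.filter (fun i => c n i = 0), (s n).exc.filter (fun i => c n i = 0)⟩ = (s n).shade)
    (hgen : ∀ n, ∀ E ∈ (s n).F.support, (E.degree : ℕ∞) = ordZero (s n).F →
      ∀ i, (s n).r i = 0 → c n i = 0 → ¬ p ∣ E i →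
        ∑ D ∈ (s n).F.support with (∀ k, c n k = 0 → D k = E k),
          coeff D (s n).F * ∏ k ∈ (Finset.univ.filter fun k => c n k = 0)ᶜ, c n k ^ D k ≠ 0)
    {n m : ℕ} (hnm : n ≤ m) : (s m).shade ≤ (s n).shade + 1 := by
  -- the moved state at stage `n`
  let M : ℕ → CState σ K := fun n => ⟨deletePthPowers p (PointBlowup.translate (c n) (s n).F),
    (s n).r.filter (fun i => c n i = 0), (s n).exc.filter (fun i => c n i = 0)⟩
  have hMdef : ∀ n, M n = ⟨deletePthPowers p (PointBlowup.translate (c n) (s n).F),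
    (s n).r.filter (fun i => c n i = 0), (s n).exc.filter (fun i => c n i = 0)⟩ := fun n => rfl
  -- invariants along the sequence: non-zero, cleaned, divisible by the exceptional monomial
  have hinv : ∀ n, (s n).F ≠ 0 ∧ deletePthPowers p (s n).F = (s n).F ∧
      ∀ d ∈ (s n).F.support, (s n).r ≤ d := by
    intro n
    induction n with
    | zero => exact ⟨hF0, hclean, hr⟩
    | succ n ih =>
      obtain ⟨ih0, ih1, ih2⟩ := ih
      have hMF : (M n).F ≠ 0 := clean_translate_ne_zero p (c n) ih1 ih0
      obtain ⟨oM, hoM⟩ := exists_ordZero_eq_natCast hMF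
      obtain ⟨hclM, hrM, hqM, hpermM⟩ :=
        JumpLedger.translate_hypotheses p (c n) (hc n) (s n) ih1 ih2 (hq n) (hperm n) (hnojump n) hoM
      rw [hstep n, step_add_eq_step_translate_clean_one p (hj n) (b' n) (c n) (hb' n) (hc n) (s n) ih1]
      exact ⟨step_F_ne_zero p (hj n) (b' n) (hb'j n) (hb' n) (M n) hclM hoM hrM hqM,
        deletePthPowers_step p (S n) (j n) (b' n) (M n),
        newMult_le_of_mem_support_step p (S n) (j n) (b' n) (hb'j n) (M n) hoM hrM hpermM⟩
  have hnat : ∀ n, ∃ o : ℕ, ordZero (s n).F = o := fun n => exists_ordZero_eq_natCast (hinv n).1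
  -- the witness predicate
  let W : CState σ K → Prop := fun t =>
    ∃ (i : σ) (o : ℕ) (E : σ →₀ ℕ), ordZero t.F = o ∧ E ∈ t.F.support ∧ E.degree = o ∧
      ¬ p ∣ E i ∧ t.r i = 0
  -- one stage: the step at `b' + c` is the fibre step of the moved state, which keeps the shade
  have hstage : ∀ k, ∃ oM : ℕ, ordZero (M k).F = oM ∧ (M k).shade = (s k).shade ∧
      deletePthPowers p (M k).F = (M k).F ∧ (∀ e ∈ (M k).F.support, (M k).r ≤ e) ∧
      (∀ e ∈ (M k).F.support, p ≤ degIn (S k) e) ∧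
      (∀ e ∈ (M k).F.support, degIn (S k) (M k).r + (oM - (M k).r.degree) ≤ degIn (S k) e) ∧
      s (k + 1) = step p (S k) (j k) (b' k) (M k) := by
    intro k
    obtain ⟨h0, hcl, hrk⟩ := hinv k
    have hMF : (M k).F ≠ 0 := clean_translate_ne_zero p (c k) hcl h0
    obtain ⟨oM, hoM⟩ := exists_ordZero_eq_natCast hMF
    obtain ⟨hclM, hrM, hqM, hpermM⟩ :=
      JumpLedger.translate_hypotheses p (c k) (hc k) (s k) hcl hrk (hq k) (hperm k) (hnojump k) hoM
    refine ⟨oM, hoM, hnojump k, hclM, hrM, hqM, hpermM, ?_⟩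
    rw [hstep k, step_add_eq_step_translate_clean_one p (hj k) (b' k) (c k) (hb' k) (hc k) (s k) hcl]
  -- the witness moves along with the state
  have hWmove : ∀ k, W (s k) → W (M k) := by
    intro k ⟨i₀, o, E, ho, hE, hEdeg, hEi, hri⟩
    obtain ⟨h0, hcl, hrk⟩ := hinv k
    have hpermN := perm_of_shade_le_ordAlong (s k) ho (hperm k)
    -- the witness variable is untranslated: otherwise `E i₀ = r i₀ = 0`
    have hci₀ : c k i₀ = 0 := by
      by_contra hne
      have hi₀S : i₀ ∉ S k := fun h => hne (hc k i₀ h)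
      have := (apply_eq_of_initial (s k) hpermN hE (hrk E hE) hEdeg).1 i₀ hi₀S
      rw [this, hri] at hEi
      exact hEi (dvd_zero p)
    have hsum := hgen k E hE (by rw [ho, hEdeg]) i₀ hri hci₀ hEi
    obtain ⟨heM, hordM, heMdeg, hei₀⟩ :=
      exists_witness_translate p (c k) (hc k) (s k) hrk hpermN hci₀ hE hEdeg hEi hsum
    refine ⟨i₀, _, _, hordM, heM, heMdeg, by rw [hei₀]; exact hEi, ?_⟩
    show ((s k).r.filter (fun i => c k i = 0)) i₀ = 0
    rw [Finsupp.filter_apply, if_pos hci₀, hri]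
  obtain ⟨a, ha⟩ := hnat n
  have hshade_n : (s n).shade = ((a - (s n).r.degree : ℕ) : ℕ∞) :=
    CState.shade_eq_of_ordZero_eq _ ha
  obtain ⟨k, rfl⟩ := Nat.exists_eq_add_of_le hnm
  clear hnm
  suffices hk : (s (n + k)).shade ≤ (s n).shade + 1 ∧
      ((s (n + k)).shade = (s n).shade + 1 → W (s (n + k))) from hk.1
  induction k with
  | zero =>
    refine ⟨le_self_add, fun h => ?_⟩
    exfalso
    rw [Nat.add_zero, hshade_n] at h
    have : (a - (s n).r.degree : ℕ) = (a - (s n).r.degree) + 1 := by exact_mod_cast h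
    omega
  | succ k ih =>
    obtain ⟨ih1, ih2⟩ := ih
    obtain ⟨oM, hoM, hMshade, hclM, hrM, hqM, hpermM, hstepk'⟩ := hstage (n + k)
    have hstepk : s (n + (k + 1)) = step p (S (n + k)) (j (n + k)) (b' (n + k)) (M (n + k)) := by
      rw [← Nat.add_assoc]; exact hstepk'
    have hshade_k : (M (n + k)).shade = ((oM - (M (n + k)).r.degree : ℕ) : ℕ∞) :=
      CState.shade_eq_of_ordZero_eq _ hoM
    by_cases htop : (s (n + k)).shade = (s n).shade + 1
    · -- at the top: the witness moves to `c`, forbids an increase and survives a stall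
      obtain ⟨i₀, o', E, ho', hE, hEdeg, hEi, hri⟩ := hWmove (n + k) (ih2 htop)
      have hoo : o' = oM := by
        have := ho'.symm.trans hoM
        exact_mod_cast this
      subst hoo
      have hle := shade_step_le_of_witness p (hj (n + k)) (b' (n + k)) (hb'j (n + k)) (hb' (n + k))
        (M (n + k)) ho' hrM hqM hpermM hri hE hEdeg hEi
      rw [← hstepk, hMshade] at hle
      refine ⟨le_trans hle (le_of_eq htop), fun heq => ?_⟩
      have hstall : (step p (S (n + k)) (j (n + k)) (b' (n + k)) (M (n + k))).shade
          = (M (n + k)).shade := by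
        rw [← hstepk, heq, hMshade, htop]
      obtain ⟨i₁, o₁, E₁, ho₁, hE₁, hE₁deg, hE₁i, hr₁⟩ :=
        exists_witness_step_of_shade_eq p (hj (n + k)) (b' (n + k)) (hb'j (n + k)) (hb' (n + k))
          (M (n + k)) hclM ho' hrM hqM hpermM hri hE hEdeg hEi hstall
      rw [← hstepk] at ho₁ hE₁ hr₁
      exact ⟨i₁, o₁, E₁, ho₁, hE₁, hE₁deg, hE₁i, hr₁⟩
    · -- below the top: Moh's one-step bound at the moved state, and an increase creates the witness
      have hlt : (s (n + k)).shade < (s n).shade + 1 := lt_of_le_of_ne ih1 htop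
      have hle : (s (n + k)).shade ≤ (s n).shade := by
        rw [← hMshade, hshade_k, hshade_n] at hlt ⊢
        have : (oM - (M (n + k)).r.degree : ℕ) < (a - (s n).r.degree) + 1 := by exact_mod_cast hlt
        exact_mod_cast (by omega : (oM - (M (n + k)).r.degree : ℕ) ≤ (a - (s n).r.degree))
      have hMb := mohBound_one p (hj (n + k)) (b' (n + k)) (hb'j (n + k)) (hb' (n + k)) (M (n + k))
        hclM hoM hrM hqM hpermM
      rw [← hstepk, hMshade] at hMb
      refine ⟨le_trans hMb (add_le_add hle le_rfl), fun heq => ?_⟩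
      have hinc : ShadeIncreases p (S (n + k)) (j (n + k)) (b' (n + k)) (M (n + k)) := by
        unfold ShadeIncreases
        rw [← hstepk, heq, hMshade]
        exact lt_of_le_of_lt hle (by
          rw [hshade_n]
          exact_mod_cast (by omega : (a - (s n).r.degree : ℕ) < (a - (s n).r.degree) + 1))
      obtain ⟨i₀, o₁, E, ho₁, hE, hEdeg, hEi₀, hr1i₀⟩ :=
        exists_witness_of_shadeIncreases p (hj (n + k)) (b' (n + k)) (hb'j (n + k)) (hb' (n + k))
          (M (n + k)) hclM hoM hrM hqM hpermM hinc
      rw [← hstepk] at ho₁ hE hr1i₀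
      exact ⟨i₀, o₁, E, ho₁, hE, hEdeg, hEi₀, hr1i₀⟩

end Along

end MohAlong

end Summit.ResolutionOfSingularities.ResolutionOfSingularities.Theorems.PIDim4

end
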